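import Literature.AlgebraicGeometry.Frobenioids.ArchimedeanSlitMorphisms
import Literature.AlgebraicGeometry.Frobenioids.ArchimedeanSlitRegion
import Literature.AlgebraicGeometry.Frobenioids.ArchimedeanFSMMonoCondBR
import Literature.AlgebraicGeometry.Frobenioids.ArchimedeanPullbacks
import Literature.AlgebraicGeometry.Frobenioids.FiberProductsMorphisms
import HarnessLib

/-!
# Frobenioids II, Example 3.3 (v): slit morphisms of `C`, `A`, `N`, `R` EXIST over any base with a
# complex object — PROOFS (abc-iut cell, layer L1, node `FrdII:Ex3.3(v)`, NV-L1 row «Ex33v-slit»)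

Mochizuki, *The geometry of Frobenioids II: poly-Frobenioids*, Kyushu J. Math. **62** (2008)
401–460, §3, Example 3.3 (v), author's text p. 29 ll. 40–44 [cite: MochizukiFrdII2008, Ex 3.3 (v) p.29]:
"if `F` is one of the categories `A`, `N`, `R`, then any morphism of `F` that is obtained as the
isotropic hull of an object of `F` whose angular region is determined by the complement in `S¹` of a
single element of `S¹` is an FSMI-morphism of `F` … We shall refer to such a morphism as a *slit
morphism* of `F`. Note that the existence of slit morphisms implies that `F` is not of FSM-type."

The tree types slit morphisms (`ArchFrd.C/A/N/R.IsSlitMorphism`, abc-iut-L1-t6,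
`AngularFrobenioidsRelative.lean`) and PROVES that they are FSMI-morphisms and that their existence
forces `F` not to be of FSM-type (`ArchimedeanSlitMorphisms.lean`: `Ex33v_slit_isFSMI_*_holds`,
`Ex33v_not_FSMType_*_holds`, the latter with the EXISTENCE of a slit morphism as hypothesis). Print
presumes that existence as soon as the base has a complex object (over a real `K` every angular region
is the whole of `O_K^× = {±1}`-rays' complexification, so no slit region lives over `Spec ℝ`).

PROVED here (proof-only, nothing defined; inputs BY NAME):
* `PreFrobenioid.isIsometry_of_isIsometry_comp` — generic: if `f` and `f ≫ g` are isometries and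
  `Base(f)` is invertible then `g` is an isometry ([FrdI] Rem. 1.1.1 divisor calculus);
* `PreFrobenioid.FiberProduct.isIsotropicHull_of_fst` — generic ([FrdI] Prop. 1.6 (v) pattern): an
  arrow of `C ×_D D′` with invertible `D′`-component whose `C`-component is an isotropic hull is an
  isotropic hull of `C ×_D D′`;
* `ArchFrd.C.exists_isSlitMorphism`, `ArchFrd.A.exists_isSlitMorphism`, `ArchFrd.N.exists_isSlitMorphism`,
  `ArchFrd.R.exists_isSlitMorphism` — over any `π : D → D₀` with `∃ d, π(d) = Spec ℂ`, the isotropic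
  hull ([FrdI] Def. 1.2 (iv); `ArchFrd.C0.vii_a`) of the object `(Spec ℂ, slit region of tip 1)`
  (`ArchFrd.slitRegion`, abc-iut-L1-t6) over `d`, rigidified for `R` through the structure arrow
  `(Spec ℂ → Spec ℝ, 1, i)` to the real unit, is a slit morphism;
* hence the UNCONDITIONAL forms of Ex. 3.3 (v)'s last sentence at such bases:
  `ArchFrd.A.not_isOfFSMType`, `ArchFrd.N.not_isOfFSMType`, `ArchFrd.R.not_isOfFSMType`
  (via `Ex33v_not_FSMType_*_holds`), and their instances `…_id` over `D := D₀` itself.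
No statement of the paper is strengthened; nothing here bears on [IUTchIII] Cor. 3.12.
Seat abc-iut-w5-d154 (gen 3), GO abc-iut-L1-t6 g3 2026-08-26T05:10:33Z.
-/

namespace Literature.AlgebraicGeometry.Frobenioids

open CategoryTheory Set
open scoped Pointwise

noncomputable section

/-! ### Two generic pre-Frobenioid lemmas -/

namespace PreFrobenioid

universe w v v' v'' u u' u''

variable {D : Type u} [Category.{v} D] {D' : Type u'} [Category.{v'} D']
  {Φ : Dᵒᵖ ⥤ CommMonCat.{w}} {C : Type u''} [Category.{v''} C]
  {F : C ⥤ ElemFrobenioid Φ} {G : D' ⥤ D}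

/-- **Isometries cancel on the left along a base-isomorphism** ([FrdI] Rem. 1.1.1:
`Div(g ∘ f) = Base(f)^* Div(g) + deg_Fr(g) · Div(f)`): if `f` and `f ≫ g` are isometries and
`Base(f)` is invertible, then `g` is an isometry. [cite: MochizukiFrdI2008, Rem. 1.1.1] -/
theorem isIsometry_of_isIsometry_comp {X Y Z : C} {f : X ⟶ Y} {g : Y ⟶ Z} (hf : IsIsometry F f)
    (hfg : IsIsometry F (f ≫ g)) [IsIso (Base F f)] : IsIsometry F g := by
  have h1 : pull Φ (Base F f) (Div F g) = 1 := by
    have h : Div F (f ≫ g) = 1 := hfg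
    rwa [div_comp, show Div F f = 1 from hf, one_pow, mul_one] at h
  show Div F g = 1
  calc Div F g = pull Φ (𝟙 _) (Div F g) := (pull_id Φ _ _).symm
    _ = pull Φ (inv (Base F f) ≫ Base F f) (Div F g) := by rw [IsIso.inv_hom_id]
    _ = pull Φ (inv (Base F f)) (pull Φ (Base F f) (Div F g)) := pull_comp Φ _ _ _
    _ = 1 := by rw [h1, map_one]

/-- **Isotropic hulls of `C′ = C ×_D D′` from isotropic hulls of `C`** ([FrdI] Prop. 1.6 (v) pattern,
Def. 1.2 (iv)): an arrow `(h, g′)` of `C′` with `g′` invertible whose `C`-component `h` is an isotropic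
hull of `C` is an isotropic hull of `C′` (the unique factorisations of `C` lift componentwise).
[cite: MochizukiFrdI2008, Prop. 1.6] -/
theorem FiberProduct.isIsotropicHull_of_fst {X Y : FiberProduct F G} (η : X ⟶ Y) [IsIso η.snd]
    (hη : IsIsotropicHull F η.fst) : IsIsotropicHull (fiberProductFunctor F G) η := by
  haveI : IsIso (Base F η.fst) := hη.2.1.2
  refine ⟨(isIsometry_fiberProduct_iff η).mpr hη.1, ⟨hη.2.1.1, (inferInstance : IsIso η.snd)⟩,
    (isIsotropic_fiberProduct_iff Y).mpr hη.2.2.1, fun Z γ hZ => ?_⟩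
  obtain ⟨β₀, hβ₀, huniq⟩ := hη.2.2.2 γ.fst ((isIsotropic_fiberProduct_iff Z).mp hZ)
  have w : Base F β₀ ≫ Z.e.hom = Y.e.hom ≫ G.map (inv η.snd ≫ γ.snd) := by
    rw [← cancel_epi (Base F η.fst)]
    calc Base F η.fst ≫ Base F β₀ ≫ Z.e.hom = Base F (η.fst ≫ β₀) ≫ Z.e.hom := by
          rw [base_comp, Category.assoc]
      _ = X.e.hom ≫ G.map γ.snd := by rw [hβ₀, FiberProduct.hom_w γ]
      _ = X.e.hom ≫ G.map (η.snd ≫ inv η.snd ≫ γ.snd) := by rw [IsIso.hom_inv_id_assoc]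
      _ = Base F η.fst ≫ Y.e.hom ≫ G.map (inv η.snd ≫ γ.snd) := by
          rw [G.map_comp, ← Category.assoc, ← FiberProduct.hom_w η, Category.assoc]
  let β : Y ⟶ Z := ⟨β₀, inv η.snd ≫ γ.snd, w⟩
  refine ⟨β, CFP.hom_ext hβ₀ ?_, fun β' hβ' => CFP.hom_ext ?_ ?_⟩
  · show η.snd ≫ inv η.snd ≫ γ.snd = γ.snd
    rw [IsIso.hom_inv_id_assoc]
  · exact huniq β'.fst (congrArg CFP.Hom.fst hβ')
  · have h2 : η.snd ≫ β'.snd = γ.snd := congrArg CFP.Hom.snd hβ'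
    show β'.snd = inv η.snd ≫ γ.snd
    rw [← h2, IsIso.inv_hom_id_assoc]

end PreFrobenioid

/-! ### Slit morphisms exist -/

namespace ArchFrd

universe v u

variable {D : Type u} [Category.{v} D] (π : D ⥤ D0)

/-- The slit region of tip `t` (angular part `S¹ ∖ {−1}`, abc-iut-L1-t6's `slitRegion`) is a slit region
in the sense of `IsSlitRegion` ("determined by the complement in `S¹` of a single element").
[cite: MochizukiFrdII2008, Ex 3.3 (v) p.29] -/
theorem isSlitRegion_slitRegion (t : PosReal) : IsSlitRegion (slitRegion t) :=
  ⟨negOneUnit, by ext z; simp [slitRegion_dir]⟩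

/-- **Slit morphisms of `C` exist** over any base `π : D → D₀` with a complex object: the isotropic hull
(in `C = C₀ ×_{D₀} D`) of `(Spec ℂ, slit region of tip 1)` placed over `d` with `π(d) = Spec ℂ`.
[cite: MochizukiFrdII2008, Ex 3.3 (v) p.29] -/
theorem C.exists_isSlitMorphism (hd : ∃ d : D, (π.obj d).IsComplex) :
    ∃ (X Y : C π) (φ : X ⟶ Y), C.IsSlitMorphism π φ := by
  obtain ⟨d, hd⟩ := hd
  have hd' : π.obj d = D0.complex := hd
  let X₀ : C0 := ⟨D0.complex, slitRegion 1, fun h => nomatch h⟩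
  obtain ⟨Y₀, h₀, hh₀⟩ := C0.vii_a X₀
  have hb : IsIso (PreFrobenioid.Base C0.toElem h₀) := hh₀.2.1.2
  let X : C π := ⟨X₀, d, eqToIso hd'.symm⟩
  let η : X ⟶ PreFrobenioid.FiberProduct.liftTgt X h₀ hb :=
    PreFrobenioid.FiberProduct.liftTgtHom X h₀ hb
  haveI : IsIso η.snd := by change IsIso (𝟙 d); infer_instance
  exact ⟨X, _, η, PreFrobenioid.FiberProduct.isIsotropicHull_of_fst η hh₀, isSlitRegion_slitRegion 1⟩

/-- **Slit morphisms of `A` exist** over any base with a complex object: the same arrow is an isotropic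
hull for `A`'s own structure `(Base, 0, deg_Fr)` — isotropic objects of `A` are the objects with full
angular part (`A.isIsotropic_iff_isNaivelyIsotropic`), and the unique factor through the `C`-hull of an
isometry is itself an isometry (`PreFrobenioid.isIsometry_of_isIsometry_comp`).
[cite: MochizukiFrdII2008, Ex 3.3 (v) p.29] -/
theorem A.exists_isSlitMorphism (hd : ∃ d : D, (π.obj d).IsComplex) :
    ∃ (X Y : A π) (φ : X ⟶ Y), A.IsSlitMorphism π φ := by
  obtain ⟨d, hd⟩ := hd
  have hd' : π.obj d = D0.complex := hd
  let X₀ : C0 := ⟨D0.complex, slitRegion 1, fun h => nomatch h⟩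
  obtain ⟨Y₀, h₀, hh₀⟩ := C0.vii_a X₀
  have hb : IsIso (PreFrobenioid.Base C0.toElem h₀) := hh₀.2.1.2
  let X : C π := ⟨X₀, d, eqToIso hd'.symm⟩
  let Y : C π := PreFrobenioid.FiberProduct.liftTgt X h₀ hb
  let η : X ⟶ Y := PreFrobenioid.FiberProduct.liftTgtHom X h₀ hb
  haveI hηs : IsIso η.snd := by change IsIso (𝟙 d); infer_instance
  have hηC : PreFrobenioid.IsIsotropicHull (C.toElem π) η :=
    PreFrobenioid.FiberProduct.isIsotropicHull_of_fst η hh₀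
  haveI : IsIso (PreFrobenioid.Base (C.toElem π) η) := hηs
  let ηA : (⟨X⟩ : A π) ⟶ ⟨Y⟩ := ⟨η, hηC.1⟩
  have hYn : Y.fst.IsNaivelyIsotropic := (C0.isIsotropic_iff_isNaivelyIsotropic Y₀).mp hh₀.2.2.1
  refine ⟨⟨X⟩, ⟨Y⟩, ηA, ⟨Subsingleton.elim _ _, ⟨hh₀.2.1.1, ?_⟩,
    (A.isIsotropic_iff_isNaivelyIsotropic π ⟨Y⟩).mpr hYn, fun W γ hW => ?_⟩, isSlitRegion_slitRegion 1⟩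
  · change IsIso (𝟙 d); infer_instance
  · have hWn : W.obj.fst.IsNaivelyIsotropic := (A.isIsotropic_iff_isNaivelyIsotropic π W).mp hW
    have hWC : PreFrobenioid.IsIsotropic (C.toElem π) W.obj :=
      (PreFrobenioid.isIsotropic_fiberProduct_iff W.obj).mpr (C0.isIsotropic_of_isNaivelyIsotropic hWn)
    obtain ⟨βC, hβC, huC⟩ := hηC.2.2.2 γ.1 hWC
    have hβiso : PreFrobenioid.isometricMorphisms (C.toElem π) βC :=
      PreFrobenioid.isIsometry_of_isIsometry_comp (f := η) hηC.1 (by rw [hβC]; exact γ.2)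
    refine ⟨⟨βC, hβiso⟩, WideSubcategory.hom_ext _ hβC, fun β' hβ' => ?_⟩
    exact WideSubcategory.hom_ext _ (huC β'.1 (congrArg (fun k => k.1) hβ'))

/-- **Slit morphisms of `N` exist** over any base with a complex object (Frobenioid-theoretic words for
`N` refer to images in `C`, p. 29): the `C`-hull above is a linear isometry, i.e. an arrow of `N`.
[cite: MochizukiFrdII2008, Ex 3.3 (v) p.29] -/
theorem N.exists_isSlitMorphism (hd : ∃ d : D, (π.obj d).IsComplex) :
    ∃ (X Y : N π) (φ : X ⟶ Y), N.IsSlitMorphism π φ := by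
  obtain ⟨d, hd⟩ := hd
  have hd' : π.obj d = D0.complex := hd
  let X₀ : C0 := ⟨D0.complex, slitRegion 1, fun h => nomatch h⟩
  obtain ⟨Y₀, h₀, hh₀⟩ := C0.vii_a X₀
  have hb : IsIso (PreFrobenioid.Base C0.toElem h₀) := hh₀.2.1.2
  let X : C π := ⟨X₀, d, eqToIso hd'.symm⟩
  let Y : C π := PreFrobenioid.FiberProduct.liftTgt X h₀ hb
  let η : X ⟶ Y := PreFrobenioid.FiberProduct.liftTgtHom X h₀ hb
  haveI : IsIso η.snd := by change IsIso (𝟙 d); infer_instance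
  have hηC : PreFrobenioid.IsIsotropicHull (C.toElem π) η :=
    PreFrobenioid.FiberProduct.isIsotropicHull_of_fst η hh₀
  let ηN : (⟨⟨X⟩⟩ : N π) ⟶ ⟨⟨Y⟩⟩ := ⟨⟨η, hηC.1⟩, hh₀.2.1.1⟩
  exact ⟨_, _, ηN, hηC, isSlitRegion_slitRegion 1⟩

/-- **Slit morphisms of `R` exist** over any base with a complex object (Frobenioid-theoretic words for
`R` refer to images in `C`, p. 29): the slit object `(Spec ℂ, slit region of tip 1)` is rigidified by
the structure arrow `(Spec ℂ → Spec ℝ, 1, i)` to the real unit of `N₀`, its isotropic hull is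
rigidified through the unique factorisation of that structure arrow through the hull (an isometry by
`PreFrobenioid.isIsometry_of_isIsometry_comp`, linear by degrees), and the resulting arrow of
`R = R₀ ×_{D₀} D` maps in `C` to the `C`-hull. [cite: MochizukiFrdII2008, Ex 3.3 (v) p.29] -/
theorem R.exists_isSlitMorphism (hd : ∃ d : D, (π.obj d).IsComplex) :
    ∃ (X Y : R π) (φ : X ⟶ Y), R.IsSlitMorphism π φ := by
  obtain ⟨d, hd⟩ := hd
  have hd' : π.obj d = D0.complex := hd
  let X₀ : C0 := ⟨D0.complex, slitRegion 1, fun h => nomatch h⟩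
  obtain ⟨Y₀, h₀, hh₀⟩ := C0.vii_a X₀
  haveI hb : IsIso (C0.Base h₀) := hh₀.2.1.2
  haveI hb' : IsIso (PreFrobenioid.Base C0.toElem h₀) := hh₀.2.1.2
  -- the structure arrow `(Spec ℂ → Spec ℝ, 1, i)` of the slit object to the real unit
  let Iu : ℂˣ := Units.mk0 Complex.I Complex.I_ne_zero
  have hmaps : Iu • X₀.region.carrier ^ ((1 : ℕ+) : ℕ) ⊆ C0.pullRegion (C0.realOfTip 1) D0.toRealHom := by
    rw [PNat.one_coe, pow_one]
    rintro _ ⟨x, hx, rfl⟩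
    show Iu • x ∈ D0.toRealHom.act '' (AngularRegion.isotropicOfTip (K := ℂ) 1).carrier
    unfold D0.Hom.act
    rw [D0.twists_toRealHom, D0.image_galAct_false,
      C0.mem_carrier_of_isIsotropic (AngularRegion.isIsotropic_isotropicOfTip 1), absHom_le_iff,
      smul_eq_mul, Units.val_mul, norm_mul]
    show ‖Complex.I‖ * ‖(x : ℂ)‖ ≤ ((1 : PosReal) : ℝ)
    rw [Complex.norm_I, one_mul]
    exact (absHom_le_iff x (slitRegion 1).tip).mp hx.2
  have hmem : Iu ∈ D0.scalars X₀.base := by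
    show _ ∈ D0.scalars D0.complex
    rw [D0.scalars_complex]
    exact Subgroup.mem_top _
  let s₀ : X₀ ⟶ C0.realOfTip 1 := ⟨D0.toRealHom, 1, Iu, hmem, hmaps⟩
  have hs₀ : PreFrobenioid.IsIsometry C0.toElem s₀ := by
    rw [A0.isIsometry_iff_norm_mul_tip_pow]
    show ‖Complex.I‖ * ((1 : PosReal) : ℝ) ^ ((1 : ℕ+) : ℕ) = ((1 : PosReal) : ℝ)
    rw [Complex.norm_I, one_mul, PNat.one_coe, pow_one]
  let sX : (⟨⟨X₀⟩⟩ : N0) ⟶ N0.realUnit := N0.homMk s₀ hs₀ rfl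
  -- the structure arrow of the hull: the unique factorisation of `s₀` through `h₀`
  have hU : PreFrobenioid.IsIsotropic C0.toElem (C0.realOfTip 1) :=
    C0.isIsotropic_of_isNaivelyIsotropic (C0.isNaivelyIsotropic_of_isRealObj N0.isRealObj_realUnit)
  obtain ⟨t₀, ht₀, -⟩ := hh₀.2.2.2 s₀ hU
  have ht₀iso : PreFrobenioid.IsIsometry C0.toElem t₀ :=
    PreFrobenioid.isIsometry_of_isIsometry_comp (f := h₀) hh₀.1 (by rw [ht₀]; exact hs₀)
  have ht₀lin : C0.degFr t₀ = 1 := by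
    have h := congrArg C0.degFr ht₀
    rw [C0.degFr_comp', show C0.degFr h₀ = 1 from hh₀.2.1.1, one_mul] at h
    exact h
  let sY : (⟨⟨Y₀⟩⟩ : N0) ⟶ N0.realUnit := N0.homMk t₀ ht₀iso ht₀lin
  let n : (⟨⟨X₀⟩⟩ : N0) ⟶ (⟨⟨Y₀⟩⟩ : N0) := N0.homMk h₀ hh₀.1 hh₀.2.1.1
  have hn : n ≫ sY = sX := N0.hom_ext ht₀
  -- the objects and the arrow of `R = R₀ ×_{D₀} D`
  let rX : R0 := Over.mk sX
  let rY : R0 := Over.mk sY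
  let φO : rX ⟶ rY := Over.homMk n hn
  let XR : R π := ⟨rX, d, eqToIso hd'.symm⟩
  let YR : R π := ⟨rY, d, (asIso (C0.Base h₀)).symm ≪≫ eqToIso hd'.symm⟩
  have w : R0.toD0.map φO ≫ YR.iso.hom = XR.iso.hom ≫ π.map (𝟙 d) := by
    show C0.Base h₀ ≫ inv (C0.Base h₀) ≫ (eqToIso hd'.symm).hom = (eqToIso hd'.symm).hom ≫ π.map (𝟙 d)
    rw [IsIso.hom_inv_id_assoc, π.map_id, Category.comp_id]
  let φR : XR ⟶ YR := ⟨φO, 𝟙 d, w⟩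
  haveI : IsIso ((R.toC π).map φR).snd := by change IsIso (𝟙 d); infer_instance
  exact ⟨XR, YR, φR, PreFrobenioid.FiberProduct.isIsotropicHull_of_fst ((R.toC π).map φR) hh₀,
    isSlitRegion_slitRegion 1⟩

/-! ### Example 3.3 (v), last sentence, unconditionally at bases with a complex object -/

/-- **`A` is not of FSM-type** over any base with a complex object ("the existence of slit morphisms
implies that `F` is not of FSM-type", now with the existence supplied).
[cite: MochizukiFrdII2008, Ex 3.3 (v) p.29] -/
theorem A.not_isOfFSMType (hd : ∃ d : D, (π.obj d).IsComplex) : ¬ IsOfFSMType (A π) :=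
  Ex33v_not_FSMType_A_holds (A.exists_isSlitMorphism π hd)

/-- **`N` is not of FSM-type** over any base with a complex object. [cite: MochizukiFrdII2008, Ex 3.3 (v) p.29] -/
theorem N.not_isOfFSMType (hd : ∃ d : D, (π.obj d).IsComplex) : ¬ IsOfFSMType (N π) :=
  Ex33v_not_FSMType_N_holds (N.exists_isSlitMorphism π hd)

/-- **`R` is not of FSM-type** over any base with a complex object. [cite: MochizukiFrdII2008, Ex 3.3 (v) p.29] -/
theorem R.not_isOfFSMType (hd : ∃ d : D, (π.obj d).IsComplex) : ¬ IsOfFSMType (R π) :=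
  Ex33v_not_FSMType_R_holds (R.exists_isSlitMorphism π hd)

/-- In particular, over the base `D := D₀` itself (`π = 𝟭`, complex object `Spec ℂ`): the angular
Frobenioid `A = A₀ ×_{D₀} D₀` is not of FSM-type. [cite: MochizukiFrdII2008, Ex 3.3 (v) p.29] -/
theorem A.not_isOfFSMType_id : ¬ IsOfFSMType (A (𝟭 D0)) :=
  A.not_isOfFSMType (𝟭 D0) ⟨D0.complex, rfl⟩

/-- Over `D := D₀` itself: the non-rigidified angloid `N` is not of FSM-type. [cite: MochizukiFrdII2008, Ex 3.3 (v) p.29] -/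
theorem N.not_isOfFSMType_id : ¬ IsOfFSMType (N (𝟭 D0)) :=
  N.not_isOfFSMType (𝟭 D0) ⟨D0.complex, rfl⟩

/-- Over `D := D₀` itself: the rigidified angloid `R` is not of FSM-type. [cite: MochizukiFrdII2008, Ex 3.3 (v) p.29] -/
theorem R.not_isOfFSMType_id : ¬ IsOfFSMType (R (𝟭 D0)) :=
  R.not_isOfFSMType (𝟭 D0) ⟨D0.complex, rfl⟩

end ArchFrd

end

end Literature.AlgebraicGeometry.Frobenioids
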